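import Literature.Geometry.Riemannian.BakryEmeryHeatFlow
import Literature.Geometry.Lorentzian.RicciNormSq
import HarnessLib

/-!
# The `R`-flux identity family on a closed normalised 4-d gradient shrinker
(stub `stub_fluxIdentityR` of line `cgy-variance-pivot`, crux `EntropyRung.CompactShrinkerGap`,
item stmt-SmoothPoincare4-10870)

For a Riemannian metric `g` (Levi-Civita connection) on a closed `4`-manifold and a smooth `f`
with `Ric + Hess f = g/2` and `R + |∇f|² = f` (a normalised gradient shrinker, `τ = 1`), GIVEN
the pointwise identity (B) `ΔR = g⁻¹(dR, df) + R − 2|Ric|²` (i.e. `Δ_f R = R − 2|Ric|²` for the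
drift Laplacian `Δ_f u = Δu − g⁻¹(df, du)`), and any smooth `φ : ℝ → ℝ`:

  `∫_M (φ(f) (R − 2|Ric|²) + (f − R) (φ'(f) (3 − f) + φ''(f) (f − R))) e^{-f} dV = 0`.

This is the equation `Δ_f R = R − 2|Ric|²` tested against `φ(f) e^{-f} dV`.

Proof (two weighted Green identities for the measure `e^{-f} dV` on the closed manifold, every
integrand being continuous on a compact manifold of finite volume). Write `G = |∇f|² = f − R`
and `P = φ''(f) G + φ'(f) (2 − f)`.
* The chain rules `d(φ ∘ f) = φ'(f) df` (`mvfderiv_real_comp`) and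
  `Δ(φ ∘ f) = φ''(f) |∇f|² + φ'(f) Δf` (`dalembertian_real_comp`), with the traced soliton
  equation `Δf = 2 − R` (`IsGradientShrinker.scalarCurvature_add_dalembertian_one`,
  `finrank ℝ ℝ⁴ = 4`) and the normalisation, give `g⁻¹(df, d(φ ∘ f)) = φ'(f) G` and
  `Δ_f (φ ∘ f) = φ''(f) G + φ'(f) (2 − R − G) = P`.
* Symmetry of `Δ_f` for `e^{-f} dV` (`integral_mul_weightedLaplacian_comm`, Carrillo–Ni §3) and
  (B): `∫ φ(f) (R − 2|Ric|²) e^{-f} = ∫ φ(f) (Δ_f R) e^{-f} = ∫ R (Δ_f (φ ∘ f)) e^{-f} = ∫ R P e^{-f}`.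
* The weighted Green identity (`integral_mul_weightedLaplacian`) with `a = f`, `b = φ ∘ f`:
  `∫ f P e^{-f} = −∫ g⁻¹(df, d(φ ∘ f)) e^{-f} = −∫ φ'(f) G e^{-f}`.
* Pointwise, `(f − R)(φ'(3 − f) + φ''(f − R)) = φ' G + (f − R) P = φ' G + f P − R P`, so the
  claimed integral is `(∫ φ(f)(R − 2|Ric|²) e^{-f} − ∫ R P e^{-f}) + (∫ f P e^{-f} + ∫ φ' G e^{-f})
  = 0 + 0`.

Sanity members: `φ ≡ 1` gives W2 `∫ R e^{-f} = 2 ∫ |Ric|² e^{-f}`; `φ = e^{c} − e^{t}` gives the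
Cheng–Ribeiro–Zhou defect identity. On the round `S⁴(√6)` with `f ≡ 2 = R`, `|Ric|² ≡ 1` every
member reads `0 = 0`.
Everything is proved; no definition, no named fact.

References: J. A. Carrillo, L. Ni, Comm. Anal. Geom. 17 (2009), §2 (2.1)–(2.3) and §3 (3.1)–(3.2)
[CarrilloNi2009]; H.-D. Cao, M. Zhu, arXiv:1008.0842, (3.6)–(3.7) [CaoZhu2010];
X. Cheng, E. Ribeiro Jr, D. Zhou, arXiv:2203.14916, Lemma 1 and §3.2 [ChengRibeiroZhou2022];
J. M. Lee, *Introduction to Riemannian Manifolds* (2018), Problem 2-23 [Lee2018].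
-/

noncomputable section

-- the registered namespace `Summit.SmoothPoincare4.SmoothPoincare4.Theorems` repeats a component
set_option linter.dupNamespace false

open Bundle Set Function Filter Module MeasureTheory
open scoped Manifold ContDiff Topology

namespace Summit.SmoothPoincare4.SmoothPoincare4.Theorems

open Literature.Geometry Literature.Geometry.Lorentzian Literature.Geometry.Riemannian
  Literature.Geometry.Lorentzian.PseudoRiemannianMetric

/-- **STUB `stub_fluxIdentityR` of line `cgy-variance-pivot` — the `R`-flux identity family of a
closed normalised shrinker.** For `g` Riemannian (Levi-Civita) on a closed 4-manifold, `f` smooth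
with `Ric + Hess f = g/2`, `R + |∇f|² = f`, GIVEN (B) `ΔR = g⁻¹(dR, df) + R − 2|Ric|²`, and any
smooth `φ : ℝ → ℝ`:
`∫ (φ(f)(R − 2|Ric|²) + (f − R)(φ'(f)(3 − f) + φ''(f)(f − R))) e^{-f} dV = 0`,
i.e. `Δ_f R = R − 2|Ric|²` tested against `φ(f) e^{-f}`.
Proof: with `G = |∇f|² = f − R`, `P = φ''(f) G + φ'(f)(2 − f) = Δ_f(φ ∘ f)`
(`dalembertian_real_comp`, `mvfderiv_real_comp`, `Δf = 2 − R` from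
`IsGradientShrinker.scalarCurvature_add_dalembertian_one` and `finrank ℝ ℝ⁴ = 4`), the symmetry
of `Δ_f` for `e^{-f} dV` (`integral_mul_weightedLaplacian_comm`) and (B) give
`∫ φ(f)(R − 2|Ric|²) e^{-f} = ∫ R P e^{-f}`, the weighted Green identity
(`integral_mul_weightedLaplacian`, `a = f`, `b = φ ∘ f`) gives `∫ f P e^{-f} = −∫ φ'(f) G e^{-f}`,
and pointwise `(f − R)(φ'(3 − f) + φ''(f − R)) = φ' G + f P − R P`.
Members: `φ ≡ 1`: W2; `φ = e^{c} − e^{t}`: the CRZ defect identity. Check: round `S⁴(√6)`,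
`f ≡ 2 = R`, `|Ric|² ≡ 1`: `0 = 0`.
[cite: CarrilloNi2009, §3 (3.1)–(3.2)] [cite: CaoZhu2010, (3.6)–(3.7)]
[cite: Lee2018, Problem 2-23 (a)] -/
theorem stub_fluxIdentityR :
    ∀ (M : Type) [TopologicalSpace M] [T2Space M] [SecondCountableTopology M]
      [ChartedSpace (EuclideanSpace ℝ (Fin 4)) M] [IsManifold (𝓡 4) ∞ M] [CompactSpace M]
      [T3Space M] [MeasurableSpace M] [BorelSpace M]
      (g : Literature.Geometry.Lorentzian.PseudoRiemannianMetric (𝓡 4) ∞ (EuclideanSpace ℝ (Fin 4))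
        (TangentSpace (𝓡 4) : M → Type _)) [g.HasLeviCivita] (f : M → ℝ) (hg : g.IsRiemannian),
      ContMDiff (𝓡 4) 𝓘(ℝ, ℝ) ∞ f →
      (∀ (x : M) (X Y : TangentSpace (𝓡 4) x),
        g.ricci x X Y + g.hessian f x X Y = (1 / 2 : ℝ) * g.val x X Y) →
      (∀ x : M, g.scalarCurvature x + g.gradSq f x = f x) →
      (∀ x : M, g.dalembertian g.scalarCurvature x =
        g.innerDual x (mvfderiv (𝓡 4) g.scalarCurvature x : TangentSpace (𝓡 4) x →ₗ[ℝ] ℝ)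
            (mvfderiv (𝓡 4) f x : TangentSpace (𝓡 4) x →ₗ[ℝ] ℝ) +
          g.scalarCurvature x - 2 * g.normSq x (g.ricci x)) →
      ∀ φ : ℝ → ℝ, ContDiff ℝ ∞ φ →
      ∫ x, (φ (f x) * (g.scalarCurvature x - 2 * g.normSq x (g.ricci x)) +
            (f x - g.scalarCurvature x) *
              (deriv φ (f x) * (3 - f x) + deriv (deriv φ) (f x) * (f x - g.scalarCurvature x))) *
          Real.exp (-f x)
          ∂(Literature.Geometry.Lorentzian.riemannianMeasure (g.toContMDiffRiemannianMetric hg)) = 0 := by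
  intro M _ _ _ _ _ _ _ _ _ g _ f hg hf hsol hnorm hB φ hφ
  -- the Riemannian measure is `g.riemVolume`
  have hV : g.riemVolume = riemannianMeasure (g.toContMDiffRiemannianMetric hg) :=
    PseudoRiemannianMetric.riemVolume_eq hg
  rw [← hV]
  have hE : finrank ℝ (EuclideanSpace ℝ (Fin 4)) = 4 := finrank_euclideanSpace_fin
  -- the traced soliton equation `R + Δf = 2` and the normalisation `|∇f|² = f − R`
  have hshr : g.IsGradientShrinker f 1 := (g.isGradientShrinker_one_iff f).2 hsol
  have hΔf : ∀ x, g.dalembertian f x = 2 - g.scalarCurvature x := fun x ↦ by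
    have h := hshr.scalarCurvature_add_dalembertian_one x
    rw [hE] at h
    norm_num at h
    linarith
  have hG : ∀ x, g.gradSq f x = f x - g.scalarCurvature x := fun x ↦ by linarith [hnorm x]
  -- regularity of `R`, `f`, `φ ∘ f`, `φ'`, `φ''`
  have hR : ContMDiff (𝓡 4) 𝓘(ℝ, ℝ) ∞ g.scalarCurvature := g.contMDiff_scalarCurvature
  have hR2 : ContMDiff (𝓡 4) 𝓘(ℝ, ℝ) 2 g.scalarCurvature :=
    hR.of_le (WithTop.coe_le_coe.mpr le_top)
  have hf1 : ContMDiff (𝓡 4) 𝓘(ℝ, ℝ) 1 f := hf.of_le (by norm_num)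
  have hf2 : ContMDiff (𝓡 4) 𝓘(ℝ, ℝ) 2 f := hf.of_le (WithTop.coe_le_coe.mpr le_top)
  have hφf : ContMDiff (𝓡 4) 𝓘(ℝ, ℝ) ∞ (φ ∘ f) := hφ.comp_contMDiff hf
  have hφf2 : ContMDiff (𝓡 4) 𝓘(ℝ, ℝ) 2 (φ ∘ f) := hφf.of_le (WithTop.coe_le_coe.mpr le_top)
  have hφd : Differentiable ℝ φ := hφ.differentiable (by simp)
  have hφ2 : ∀ t, ContDiffAt ℝ 2 φ t := fun t ↦
    (hφ.of_le (WithTop.coe_le_coe.mpr le_top)).contDiffAt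
  have hφ' : ContDiff ℝ ∞ (deriv φ) := (contDiff_infty_iff_deriv.1 hφ).2
  have hφ'' : ContDiff ℝ ∞ (deriv (deriv φ)) := (contDiff_infty_iff_deriv.1 hφ').2
  -- pointwise: the chain rule `d(φ ∘ f) = φ'(f) df`, so `g⁻¹(df, d(φ ∘ f)) = φ'(f) |∇f|²`
  have hdφ : ∀ x, (mvfderiv (𝓡 4) (φ ∘ f) x : TangentSpace (𝓡 4) x →ₗ[ℝ] ℝ) =
      deriv φ (f x) • (mvfderiv (𝓡 4) f x : TangentSpace (𝓡 4) x →ₗ[ℝ] ℝ) := fun x ↦ by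
    ext v
    simp only [ContinuousLinearMap.coe_coe, LinearMap.smul_apply, smul_eq_mul]
    exact mvfderiv_real_comp (I := 𝓡 4) (hφd (f x)) (hf1.mdifferentiableAt one_ne_zero) v
  have hI : ∀ x, g.innerDual x (mvfderiv (𝓡 4) f x : TangentSpace (𝓡 4) x →ₗ[ℝ] ℝ)
      (mvfderiv (𝓡 4) (φ ∘ f) x : TangentSpace (𝓡 4) x →ₗ[ℝ] ℝ) =
      deriv φ (f x) * (f x - g.scalarCurvature x) := fun x ↦ by
    rw [hdφ x, g.innerDual_smul_right, ← hG x]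
    rfl
  -- pointwise: `Δ(φ ∘ f) = φ''(f) |∇f|² + φ'(f) Δf`, hence the drift Laplacian
  -- `Δ_f (φ ∘ f) = φ''(f) (f − R) + φ'(f) (2 − f)`
  have hP : ∀ x, g.dalembertian (φ ∘ f) x -
      g.innerDual x (mvfderiv (𝓡 4) f x : TangentSpace (𝓡 4) x →ₗ[ℝ] ℝ)
        (mvfderiv (𝓡 4) (φ ∘ f) x : TangentSpace (𝓡 4) x →ₗ[ℝ] ℝ) =
      deriv (deriv φ) (f x) * (f x - g.scalarCurvature x) + deriv φ (f x) * (2 - f x) := by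
    intro x
    have hgrad : g.innerDual x (mvfderiv (𝓡 4) f x : TangentSpace (𝓡 4) x →ₗ[ℝ] ℝ)
        (mvfderiv (𝓡 4) f x : TangentSpace (𝓡 4) x →ₗ[ℝ] ℝ) = g.gradSq f x := rfl
    rw [g.dalembertian_real_comp (hf2 x) (hφ2 (f x)), hI x, hΔf x, hgrad, hG x]
    ring
  -- pointwise: (B) as the drift Laplacian `Δ_f R = R − 2|Ric|²`
  have hBR : ∀ x, g.dalembertian g.scalarCurvature x -
      g.innerDual x (mvfderiv (𝓡 4) f x : TangentSpace (𝓡 4) x →ₗ[ℝ] ℝ)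
        (mvfderiv (𝓡 4) g.scalarCurvature x : TangentSpace (𝓡 4) x →ₗ[ℝ] ℝ) =
      g.scalarCurvature x - 2 * g.normSq x (g.ricci x) := fun x ↦ by
    rw [hB x, g.innerDual_comm x (mvfderiv (𝓡 4) f x : TangentSpace (𝓡 4) x →ₗ[ℝ] ℝ)]
    ring
  -- (1) symmetry of `Δ_f` for `e^{-f} dV`: `∫ φ(f) (Δ_f R) e^{-f} = ∫ R (Δ_f (φ ∘ f)) e^{-f}`
  have e1 : ∫ x, φ (f x) * (g.scalarCurvature x - 2 * g.normSq x (g.ricci x)) * Real.exp (-f x)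
      ∂g.riemVolume =
      ∫ x, g.scalarCurvature x * (deriv (deriv φ) (f x) * (f x - g.scalarCurvature x) +
        deriv φ (f x) * (2 - f x)) * Real.exp (-f x) ∂g.riemVolume := by
    have h := integral_mul_weightedLaplacian_comm g hg hφf2 hR2 hf1
    simp_rw [hBR, hP, Function.comp_apply] at h
    exact h
  -- (2) the weighted Green identity with `a = f`, `b = φ ∘ f`:
  --     `∫ f (Δ_f (φ ∘ f)) e^{-f} = −∫ g⁻¹(df, d(φ ∘ f)) e^{-f} = −∫ φ'(f) |∇f|² e^{-f}`
  have e2 : ∫ x, f x * (deriv (deriv φ) (f x) * (f x - g.scalarCurvature x) +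
        deriv φ (f x) * (2 - f x)) * Real.exp (-f x) ∂g.riemVolume =
      -∫ x, deriv φ (f x) * (f x - g.scalarCurvature x) * Real.exp (-f x) ∂g.riemVolume := by
    have h := integral_mul_weightedLaplacian g hg hf1 hφf2 hf1
    simp_rw [hP, hI] at h
    exact h
  -- continuity, hence integrability, of the four pieces of the integrand
  have hRc : Continuous g.scalarCurvature := hR.continuous
  have hfc : Continuous f := hf.continuous
  have hQc : Continuous fun x ↦ g.normSq x (g.ricci x) := g.contMDiff_normSq_ricci'.continuous
  have hφc : Continuous fun x ↦ φ (f x) := hφ.continuous.comp hfc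
  have hφ'c : Continuous fun x ↦ deriv φ (f x) := hφ'.continuous.comp hfc
  have hφ''c : Continuous fun x ↦ deriv (deriv φ) (f x) := hφ''.continuous.comp hfc
  have hec : Continuous fun x ↦ Real.exp (-f x) := Real.continuous_exp.comp hfc.neg
  have hPc : Continuous fun x ↦ deriv (deriv φ) (f x) * (f x - g.scalarCurvature x) +
      deriv φ (f x) * (2 - f x) :=
    (hφ''c.mul (hfc.sub hRc)).add (hφ'c.mul (continuous_const.sub hfc))
  have i1 : Integrable (fun x ↦ φ (f x) * (g.scalarCurvature x - 2 * g.normSq x (g.ricci x)) *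
      Real.exp (-f x)) g.riemVolume :=
    g.integrable_of_continuous ((hφc.mul (hRc.sub (continuous_const.mul hQc))).mul hec)
  have i2 : Integrable (fun x ↦ g.scalarCurvature x * (deriv (deriv φ) (f x) *
      (f x - g.scalarCurvature x) + deriv φ (f x) * (2 - f x)) * Real.exp (-f x)) g.riemVolume :=
    g.integrable_of_continuous ((hRc.mul hPc).mul hec)
  have i3 : Integrable (fun x ↦ f x * (deriv (deriv φ) (f x) *
      (f x - g.scalarCurvature x) + deriv φ (f x) * (2 - f x)) * Real.exp (-f x)) g.riemVolume :=
    g.integrable_of_continuous ((hfc.mul hPc).mul hec)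
  have i4 : Integrable (fun x ↦ deriv φ (f x) * (f x - g.scalarCurvature x) * Real.exp (-f x))
      g.riemVolume :=
    g.integrable_of_continuous ((hφ'c.mul (hfc.sub hRc)).mul hec)
  -- split the integrand: `(f − R)(φ'(3 − f) + φ''(f − R)) = φ' (f − R) + f P − R P`
  have hsplit : ∀ x, (φ (f x) * (g.scalarCurvature x - 2 * g.normSq x (g.ricci x)) +
        (f x - g.scalarCurvature x) *
          (deriv φ (f x) * (3 - f x) + deriv (deriv φ) (f x) * (f x - g.scalarCurvature x))) *
      Real.exp (-f x) =
      (φ (f x) * (g.scalarCurvature x - 2 * g.normSq x (g.ricci x)) * Real.exp (-f x) -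
        g.scalarCurvature x * (deriv (deriv φ) (f x) * (f x - g.scalarCurvature x) +
          deriv φ (f x) * (2 - f x)) * Real.exp (-f x)) +
      (f x * (deriv (deriv φ) (f x) * (f x - g.scalarCurvature x) +
          deriv φ (f x) * (2 - f x)) * Real.exp (-f x) +
        deriv φ (f x) * (f x - g.scalarCurvature x) * Real.exp (-f x)) := fun x ↦ by ring
  have i12 : Integrable (fun x ↦
      φ (f x) * (g.scalarCurvature x - 2 * g.normSq x (g.ricci x)) * Real.exp (-f x) -
        g.scalarCurvature x * (deriv (deriv φ) (f x) * (f x - g.scalarCurvature x) +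
          deriv φ (f x) * (2 - f x)) * Real.exp (-f x)) g.riemVolume := i1.sub i2
  have i34 : Integrable (fun x ↦
      f x * (deriv (deriv φ) (f x) * (f x - g.scalarCurvature x) +
          deriv φ (f x) * (2 - f x)) * Real.exp (-f x) +
        deriv φ (f x) * (f x - g.scalarCurvature x) * Real.exp (-f x)) g.riemVolume := i3.add i4
  simp_rw [hsplit]
  rw [integral_add i12 i34, integral_sub i1 i2, integral_add i3 i4, e1, e2]
  ring

end Summit.SmoothPoincare4.SmoothPoincare4.Theorems

end
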